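import Summits.FinalStateConjecture.Statement
import Summits.FinalStateConjecture.FinalStateConjecture.Theorems.ChannelsResolveTameDevelopments.Negative.WaveSliceCalculus
import Summits.FinalStateConjecture.FinalStateConjecture.Theorems.ChannelsResolveTameDevelopments.Negative.ShrinkingIntervalEnergy
import Literature.Geometry.Lorentzian.ReggeWheelerTortoise

/-!
# `ChannelsResolveTameDevelopments` (stmt-FinalStateConjecture-10046, route PhotonSphereChannels) —
# negative-side lemmas III: the exterior energy is non-increasing in `|t|`; reduction of `¬K1`

* `exteriorEnergy_le_of_le`, `exteriorEnergy_le_of_le_neg` — for `V ∈ C¹`, `V ≥ 0`, `ρ ≥ 0` the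
  Literature exterior energy `exteriorEnergy V xc ρ φ t = ∫_{ρ+|t|<|x−xc|} e` of a global `C²` solution
  of `φ_tt − φ_xx + Vφ = 0` is non-increasing on `t ≥ 0` and non-decreasing on `t ≤ 0` (the two
  half-lines of `ShrinkingIntervalEnergy.lean`, the conservation law of `WaveSliceCalculus.lean`, time
  reversal `iteratedDeriv_comp_neg`).  Hence `channelEnergy_atTop_le` / `channelEnergy_atBot_le`: the
  channel energies (`liminf` along `atTop`/`atBot`) are bounded by the exterior energies at any finite
  times `±T` — the fact deferred in the module docstring of `ReggeWheelerChannels.lean`, in particular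
  `rw_channelEnergy_le` for every Regge–Wheeler line potential along a tortoise radius function
  (`contDiff_one_linePotential`).
* `not_uniformPhotonSphereChannels_of`, `channelsResolveTameDevelopments_of` — with monotonicity
  proved, `K1 = UniformPhotonSphereChannels` is refuted by (and the crux then holds EX FALSO from) two
  remaining analytic inputs stated inline: (F1) near-side velocity data are invisible to the
  `t`-polynomial kernel (`∫_{x<xc−ρ} φ_t(0)² ≤ kernelDeficit`; the finite-energy near-side kernel is
  position-type and one-dimensional by Levinson asymptotics on the exponential tail), (F2) horizon-side
  turning-point beams (for every `ρ ≥ 0`, `ε > 0` some `ℓ ≥ 2` carries a global `C²` Regge–Wheeler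
  solution with near-side velocity data and `E_ext(T) + E_ext(−T) ≤ ε E₀`; semiclassical propagation to
  finite time; numerics in the items' evidence).  Chain: `c·E₀ ≤ c·deficit ≤ ch⁺ + ch⁻ ≤
  E_ext(T) + E_ext(−T) ≤ (c/2)E₀`.

Dependency drift (fullbuild fix, 2026-08-16): the route decls `UniformPhotonSphereChannels` (item
stmt-FinalStateConjecture-10045, REFUTED by `Theorems.not_UniformPhotonSphereChannels`) and
`ChannelsResolveTameDevelopments` (item stmt-FinalStateConjecture-10046, closed moot) were dropped from
`Theses/PhotonSphereChannels.lean` at rev 7.  Theorems being append-only and `Summits/` admitting no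
vendored `Prop`, both dropped bodies are inlined VERBATIM as local notations of section `Reduction`, so
that `not_uniformPhotonSphereChannels_of` and `channelsResolveTameDevelopments_of` keep their accepted
statements (now elaborating to the `δ`-unfolding of what they denoted); the file no longer imports the
route file (it imports `Summits.FinalStateConjecture.Statement` for the vocabulary of K2's consequent).

Parallel, independent formalisation in Fréchet form (prover seat of item 10045, same day):
`Theorems/PhotonSphereChannelsEnergyIdentity.lean` (`energy_identity_affine`) and
`Theorems/PhotonSphereChannelsEnergyInequalities.lean` (`exteriorEnergy_mono_abs`, "Lemma A" of the
10045 refutation notes); the present file is the version over the Literature vocabulary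
(`ReggeWheeler.exteriorEnergy/channelEnergy/IsSolution`, `deriv`/`iteratedDeriv 2` of slices) with the
Regge–Wheeler specialisation and the reduction of the crux.

Refuter seat `refuter-cdisprove-stmt-FinalStateConjecture-10046-0`, 2026-08-15; workfile
`Cruxes/ChannelsResolveTameDevelopments/Disproof.lean`.

## References

* C. Kenig, A. Lawrie, B. Liu, W. Schlag, Adv. Math. 285 (2015) 877–936, §1 (key `KenigEtAl2015`).
* M. Dafermos, I. Rodnianski, arXiv:0811.0354, §4.1, App. F.2 (key `DafermosRodnianski2008`).
-/

noncomputable section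

open Filter Set MeasureTheory intervalIntegral
open scoped Topology ENNReal

namespace Summit.FinalStateConjecture.FinalStateConjecture.Theorems.ChannelsResolveTameDevelopments.Negative

open Literature.Geometry.Lorentzian Literature.Geometry.Lorentzian.ReggeWheeler

/-! ### The exterior energy of `C²` solutions is non-increasing in `|t|` -/

section Exterior

variable {V : ℝ → ℝ} {φ : ℝ → ℝ → ℝ}

/-- The exterior region `{ρ + |t| < |x − xc|}` is the union of two half-lines. [folklore] -/
theorem exteriorSet_eq (xc ρ t : ℝ) :
    {x : ℝ | ρ + |t| < |x - xc|} = Ioi (xc + ρ + |t|) ∪ Iio (xc - ρ - |t|) := by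
  ext x
  simp only [mem_setOf_eq, mem_union, mem_Ioi, mem_Iio]
  rw [lt_abs]
  constructor
  · rintro (h | h)
    · left; linarith
    · right; linarith
  · rintro (h | h)
    · left; linarith
    · right; linarith

/-- `exteriorEnergy` over the named density `eDen`. [folklore] -/
theorem exteriorEnergy_eq (hφ : ContDiff ℝ 2 (Function.uncurry φ)) (xc ρ t : ℝ) :
    exteriorEnergy V xc ρ φ t =
      ∫⁻ x in Ioi (xc + ρ + |t|) ∪ Iio (xc - ρ - |t|), ENNReal.ofReal (eDen V φ (t, x)) := by
  unfold exteriorEnergy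
  rw [exteriorSet_eq]
  simp_rw [energyDensity_eq hφ]

/-- **Forward monotonicity.** For a `C²` solution of `φ_tt − φ_xx + Vφ = 0` with `V ∈ C¹`,
`V ≥ 0`, and `0 ≤ ρ`: `E_ext(t) ≤ E_ext(T)` whenever `0 ≤ T ≤ t`. [folklore] -/
theorem exteriorEnergy_le_of_le (hφ : ContDiff ℝ 2 (Function.uncurry φ)) (hV1 : ContDiff ℝ 1 V)
    (hV0 : ∀ x, 0 ≤ V x) (hsol : ∀ z, IsSolutionAt V φ z) {xc ρ T t : ℝ} (hρ : 0 ≤ ρ)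
    (hT : 0 ≤ T) (hTt : T ≤ t) : exteriorEnergy V xc ρ φ t ≤ exteriorEnergy V xc ρ φ T := by
  have he : ContDiff ℝ 1 (eDen V φ) := contDiff_eDen hφ hV1
  have hF : ContDiff ℝ 1 (flux φ) := contDiff_flux hφ
  have hcons := fderiv_eDen_eq_fderiv_flux hφ hV1 hsol
  have hbound : ∀ p, |flux φ p| ≤ eDen V φ p := abs_flux_le_eDen hV0
  rw [exteriorEnergy_eq hφ, exteriorEnergy_eq hφ, abs_of_nonneg hT, abs_of_nonneg (hT.trans hTt)]
  have hdisj : Disjoint (Ioi (xc + ρ + T)) (Iio (xc - ρ - T)) := by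
    rw [Set.disjoint_iff]
    rintro x ⟨h1, h2⟩
    simp only [mem_Ioi, mem_Iio] at h1 h2
    linarith
  calc ∫⁻ x in Ioi (xc + ρ + t) ∪ Iio (xc - ρ - t), ENNReal.ofReal (eDen V φ (t, x))
      ≤ (∫⁻ x in Ioi (xc + ρ + t), ENNReal.ofReal (eDen V φ (t, x))) +
          ∫⁻ x in Iio (xc - ρ - t), ENNReal.ofReal (eDen V φ (t, x)) := lintegral_union_le _ _ _
    _ ≤ (∫⁻ x in Ioi (xc + ρ + T), ENNReal.ofReal (eDen V φ (T, x))) +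
          ∫⁻ x in Iio (xc - ρ - T), ENNReal.ofReal (eDen V φ (T, x)) := by
        gcongr ?_ + ?_
        · have := lintegral_Ioi_le he hF hcons hbound hTt (xc + ρ)
          simpa [add_assoc] using this
        · have := lintegral_Iio_le he hF hcons hbound hTt (xc - ρ)
          simpa using this
    _ = ∫⁻ x in Ioi (xc + ρ + T) ∪ Iio (xc - ρ - T), ENNReal.ofReal (eDen V φ (T, x)) :=
        (lintegral_union measurableSet_Iio hdisj).symm

/-! ### Time reversal -/

/-- Time reversal `φ(t,x) ↦ φ(−t,x)` preserves global `C²` solutions. [folklore] -/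
theorem isSolution_reverse (h : IsSolution V φ) : IsSolution V (fun t x ↦ φ (-t) x) := by
  refine ⟨?_, fun z ↦ ?_⟩
  · have : (Function.uncurry fun t x ↦ φ (-t) x) =
        Function.uncurry φ ∘ fun p : ℝ × ℝ ↦ (-p.1, p.2) := by
      funext p; rfl
    rw [this]
    exact h.1.comp (by fun_prop)
  · have h2 := h.2 (-z.1, z.2)
    unfold IsSolutionAt at h2 ⊢
    have hn : iteratedDeriv 2 (fun τ ↦ φ (-τ) z.2) z.1 = iteratedDeriv 2 (fun τ ↦ φ τ z.2) (-z.1) := by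
      rw [iteratedDeriv_comp_neg 2 (fun τ ↦ φ τ z.2) z.1]
      norm_num
    rw [hn]
    simpa using h2

/-- The energy density of the time-reversed solution at `t` is that of `φ` at `−t`. [folklore] -/
theorem energyDensity_reverse (t x : ℝ) :
    energyDensity V (fun t x ↦ φ (-t) x) t x = energyDensity V φ (-t) x := by
  unfold energyDensity
  rw [deriv_comp_neg (f := fun τ ↦ φ τ x)]
  ring

/-- The exterior energy of the time-reversed solution at `t` is that of `φ` at `−t`. [folklore] -/
theorem exteriorEnergy_reverse (xc ρ t : ℝ) :
    exteriorEnergy V xc ρ (fun t x ↦ φ (-t) x) t = exteriorEnergy V xc ρ φ (-t) := by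
  unfold exteriorEnergy
  simp_rw [energyDensity_reverse, abs_neg]

/-- **Backward monotonicity.** `E_ext(t) ≤ E_ext(−T)` whenever `t ≤ −T ≤ 0`. [folklore] -/
theorem exteriorEnergy_le_of_le_neg (hφ : ContDiff ℝ 2 (Function.uncurry φ))
    (hV1 : ContDiff ℝ 1 V) (hV0 : ∀ x, 0 ≤ V x) (hsol : ∀ z, IsSolutionAt V φ z) {xc ρ T t : ℝ}
    (hρ : 0 ≤ ρ) (hT : 0 ≤ T) (htT : t ≤ -T) :
    exteriorEnergy V xc ρ φ t ≤ exteriorEnergy V xc ρ φ (-T) := by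
  have hrev := isSolution_reverse (V := V) ⟨hφ, hsol⟩
  have h := exteriorEnergy_le_of_le hrev.1 hV1 hV0 hrev.2 (xc := xc) hρ hT (t := -t) (by linarith)
  rwa [exteriorEnergy_reverse, exteriorEnergy_reverse, neg_neg] at h

/-! ### Channel energies are bounded by finite-time exterior energies -/

/-- **(F3, forward)** `liminf_{t → +∞} E_ext(t) ≤ E_ext(T)` for every `T ≥ 0`. [folklore] -/
theorem channelEnergy_atTop_le (hφ : ContDiff ℝ 2 (Function.uncurry φ)) (hV1 : ContDiff ℝ 1 V)
    (hV0 : ∀ x, 0 ≤ V x) (hsol : ∀ z, IsSolutionAt V φ z) {xc ρ T : ℝ} (hρ : 0 ≤ ρ)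
    (hT : 0 ≤ T) : channelEnergy V xc ρ φ atTop ≤ exteriorEnergy V xc ρ φ T := by
  unfold channelEnergy
  refine Filter.liminf_le_of_frequently_le' (Filter.Eventually.frequently ?_)
  exact (eventually_ge_atTop T).mono fun t ht ↦ exteriorEnergy_le_of_le hφ hV1 hV0 hsol hρ hT ht

/-- **(F3, backward)** `liminf_{t → −∞} E_ext(t) ≤ E_ext(−T)` for every `T ≥ 0`. [folklore] -/
theorem channelEnergy_atBot_le (hφ : ContDiff ℝ 2 (Function.uncurry φ)) (hV1 : ContDiff ℝ 1 V)
    (hV0 : ∀ x, 0 ≤ V x) (hsol : ∀ z, IsSolutionAt V φ z) {xc ρ T : ℝ} (hρ : 0 ≤ ρ)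
    (hT : 0 ≤ T) : channelEnergy V xc ρ φ atBot ≤ exteriorEnergy V xc ρ φ (-T) := by
  unfold channelEnergy
  refine Filter.liminf_le_of_frequently_le' (Filter.Eventually.frequently ?_)
  exact (eventually_le_atBot (-T)).mono fun t ht ↦
    exteriorEnergy_le_of_le_neg hφ hV1 hV0 hsol hρ hT ht

end Exterior

/-! ### The Regge–Wheeler specialisation -/

section ReggeWheelerSpec

open Literature.Geometry.Lorentzian.ReggeWheeler

/-- The Regge–Wheeler line potentials along a tortoise radius function are `C¹`. [folklore] -/
theorem contDiff_one_linePotential {M : ℝ} {r : ℝ → ℝ} {xc : ℝ} (h : IsTortoiseRadius M r xc)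
    (s ℓ : ℕ) : ContDiff ℝ 1 (linePotential M s ℓ r) := by
  have hr : ContDiff ℝ 1 r := h.contDiff_one
  have hr0 : ∀ x, r x ≠ 0 := fun x ↦ (h.pos x).ne'
  unfold linePotential rwPotential
  refine (contDiff_const.sub (contDiff_const.div hr hr0)).mul
    ((contDiff_const.div (hr.pow 2) fun x ↦ pow_ne_zero 2 (hr0 x)).add
      (contDiff_const.div (hr.pow 3) fun x ↦ pow_ne_zero 3 (hr0 x)))

/-- **(F3) for the Regge–Wheeler family**: for every tortoise radius function, every `s ≤ ℓ`,
every `ρ ≥ 0`, every global `C²` solution and every `T ≥ 0`, the two channel energies are bounded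
by the exterior energies at times `±T`. [folklore] -/
theorem rw_channelEnergy_le {M : ℝ} {r : ℝ → ℝ} {xc : ℝ} (h : IsTortoiseRadius M r xc)
    {s ℓ : ℕ} (hsℓ : s ≤ ℓ) {ρ : ℝ} (hρ : 0 ≤ ρ) {φ : ℝ → ℝ → ℝ}
    (hφ : IsSolution (linePotential M s ℓ r) φ) {T : ℝ} (hT : 0 ≤ T) :
    channelEnergy (linePotential M s ℓ r) xc ρ φ atTop ≤
        exteriorEnergy (linePotential M s ℓ r) xc ρ φ T ∧
      channelEnergy (linePotential M s ℓ r) xc ρ φ atBot ≤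
        exteriorEnergy (linePotential M s ℓ r) xc ρ φ (-T) :=
  have hV0 : ∀ x, 0 ≤ linePotential M s ℓ r x :=
    linePotential_nonneg h.mass_pos.le hsℓ h.two_mul_lt
  ⟨channelEnergy_atTop_le hφ.1 (contDiff_one_linePotential h s ℓ) hV0 hφ.2 hρ hT,
    channelEnergy_atBot_le hφ.1 (contDiff_one_linePotential h s ℓ) hV0 hφ.2 hρ hT⟩

end ReggeWheelerSpec


/-! ### The reduction: with monotonicity proved, `¬K1` needs only (F1) and (F2) -/

section Reduction

/-- The near-side (horizon-side) **velocity energy** of the data of `φ` at `t = 0`: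
`∫_{x < xc − ρ} φ_t(0, x)² dx`. [folklore] -/
def nearVelocityEnergy (xc ρ : ℝ) (φ : ℝ → ℝ → ℝ) : ℝ≥0∞ :=
  ∫⁻ x in Set.Iio (xc - ρ), ENNReal.ofReal (deriv (fun τ ↦ φ τ x) 0 ^ 2)

/- Dependency drift (fullbuild fix, 2026-08-16).  The statements of the two reduction theorems below
name the route decls `UniformPhotonSphereChannels` (K1, item stmt-FinalStateConjecture-10045 — REFUTED by
`Theorems.not_UniformPhotonSphereChannels`) and `ChannelsResolveTameDevelopments` (K2 = `K1 → Φ`, item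
stmt-FinalStateConjecture-10046 — closed moot), both dropped from `Theses/PhotonSphereChannels.lean` at
rev 7.  Theorems are append-only (accepted statements stay byte-identical) and no `Prop` may be vendored
under `Summits/` (K1 is refuted, K2 moot: neither is an obligation to register), so the two dropped
bodies are inlined here VERBATIM as *local notations*: the theorems keep their accepted statements,
which now elaborate directly to the `δ`-unfolding of what they denoted before the drift.  The inlined
`let`s are the Literature definitions `linePotential`, `energyDensity`, `IsSolutionAt`, `rwKernel`,
`kernelDeficit`, `exteriorEnergy`, `channelEnergy` (defeq; the proofs below use exactly this). -/

-- K1 verbatim (dropped route decl `UniformPhotonSphereChannels`, stmt-FinalStateConjecture-10045, refuted):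
-- a local notation, see the comment above (`quotPrecheck` cannot inspect the binders of a closed
-- notation body, hence the option).
set_option quotPrecheck false in
local notation "UniformPhotonSphereChannels" =>
  (∀ M : ℝ, 0 < M → ∃ ρ₀ : ℝ, 0 ≤ ρ₀ ∧ ∃ c : ℝ, 0 < c ∧ ∀ (r : ℝ → ℝ) (xc : ℝ), (∀ x, 2 * M < r x) → (∀ x, HasDerivAt r (1 - 2 * M / r x) x) → r xc = 3 * M → ∀ (s ℓ : ℕ), s ≤ 2 → s ≤ ℓ → ∀ ρ : ℝ, ρ₀ ≤ ρ → ∀ ψ : ℝ → ℝ → ℝ, ContDiff ℝ 2 (Function.uncurry ψ) → let V : ℝ → ℝ := fun x => (1 - 2 * M / r x) * ((ℓ : ℝ) * ((ℓ : ℝ) + 1) / r x ^ 2 + (1 - (s : ℝ) ^ 2) * (2 * M) / r x ^ 3); let e : (ℝ → ℝ → ℝ) → ℝ → ℝ → ℝ := fun φ t x => deriv (fun τ => φ τ x) t ^ 2 + deriv (φ t) x ^ 2 + V x * φ t x ^ 2; let IsSol : (ℝ → ℝ → ℝ) → ℝ × ℝ → Prop := fun φ z => iteratedDeriv 2 (fun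 τ => φ τ z.2) z.1 - iteratedDeriv 2 (φ z.1) z.2 + V z.2 * φ z.1 z.2 = 0; let Ω : Set (ℝ × ℝ) := {z | ρ + |z.1| < |z.2 - xc|}; let P : Set (ℝ → ℝ → ℝ) := {p | ContDiffOn ℝ 2 (Function.uncurry p) Ω ∧ (∀ z ∈ Ω, IsSol p z) ∧ ∃ (N : ℕ) (a : ℕ → ℝ → ℝ), ∀ z ∈ Ω, p z.1 z.2 = ∑ i ∈ Finset.range N, a i z.2 * z.1 ^ i}; let Eext : ℝ → ENNReal := fun t => MeasureTheory.lintegral (MeasureTheory.volume.restrict {x : ℝ | ρ + |t| < |x - xc|}) (fun x => ENNReal.ofReal (e ψ t x)); (∀ z, IsSol ψ z) → ENNReal.ofReal c * (⨅ p ∈ P, MeasureTheory.lintegral (MeasureTheory.volume.restrict {x : ℝ | ρ < |x - xc|}) (fun x => ENNReal.ofReal (e (fun t y => ψ t y - p t y) 0 x))) ≤ Filter.liminf Eext Filter.atTop + Filter.liminf Eext Filter.atBot)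

-- K2 verbatim (dropped route decl `ChannelsResolveTameDevelopments`, stmt-FinalStateConjecture-10046,
-- moot): a local notation, see the comment above (same remark on `quotPrecheck`).
set_option quotPrecheck false in
local notation "ChannelsResolveTameDevelopments" =>
  (UniformPhotonSphereChannels → ∀ (X : Type) [TopologicalSpace X] [ChartedSpace Literature.Geometry.Lorentzian.E3 X] [IsManifold (modelWithCornersSelf ℝ Literature.Geometry.Lorentzian.E3) ((⊤ : ℕ∞) : WithTop ℕ∞) X] [T2Space X] [SecondCountableTopology X] [ConnectedSpace X], ∀ D ∈ Literature.Geometry.Lorentzian.admissibleVacuumData X, ∀ 𝒟 : Literature.Geometry.Lorentzian.VacuumCauchyDevelopment D, 𝒟.IsMaximal → _root_.Summit.FinalStateConjecture.HasCompleteNullInfinity 𝒟.toCauchyDevelopment → ((∀ (Λ : Literature.Geometry.Lorentzian.lorentzGroup) (c : Literature.Geometry.Lorentzian.E4) (M a : ℝ), Literature.Geometry.Lorentzian.Kerr.IsExtremal M a → ¬ ∃ (τ₀ : ℝ) (Ψ : (Literature.Geometry.Lorentzian.boostedKerrBackground Λ c M a).domain → 𝒟.carrier), 𝒟.toSpacetime.IsLateChart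 (Literature.Geometry.Lorentzian.boostedKerrBackground Λ c M a) Set.univ τ₀ Ψ ∧ ∀ R : ℝ, Filter.Tendsto (fun τ => 𝒟.toSpacetime.truncDeviationCk (Literature.Geometry.Lorentzian.boostedKerrBackground Λ c M a) Ψ 2 R τ) Filter.atTop (nhds 0)) ∧ ∀ [𝒟.metric.HasLeviCivita], let outer : Set 𝒟.carrier := 𝒟.metric.causalFuture 𝒟.timeOrientation (Set.range 𝒟.embed) ∩ {q | ∃ (p : X) (γ : ℝ → 𝒟.carrier) (dom : Set ℝ), 𝒟.metric.IsNormalisedNullRayFrom 𝒟.timeOrientation 𝒟.embed 𝒟.normal p γ dom ∧ ¬ BddAbove dom ∧ q ∈ 𝒟.metric.chronologicalPast 𝒟.timeOrientation (γ '' (dom ∩ Set.Ici 0))}; ∃ r₀ : ℝ, 0 < r₀ ∧ ∃ Λ : NNReal, ∀ q ∈ outer, let U : TopologicalSpace.Opens Literature.Geometry.Lorentzian.E4 := ⟨Metric.ball (0 : Literature.Geometry.Lorentzian.E4) r₀, Metric.isOpen_ball⟩; ∃ Ψ : U → 𝒟.carrier, 𝒟.toSpacetime.IsLateChart (Literature.Geometry.Lorentzian.Minkowski.backgroundOn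 U) Set.univ (-r₀) Ψ ∧ (∃ x : U, (x : Literature.Geometry.Lorentzian.E4) = 0 ∧ Ψ x = q) ∧ Literature.Geometry.Lorentzian.supCkENorm (U : Set Literature.Geometry.Lorentzian.E4) 3 (𝒟.toSpacetime.deviationExtend (Literature.Geometry.Lorentzian.Minkowski.backgroundOn U) Ψ) ≤ (Λ : ENNReal) ∧ Literature.Geometry.Lorentzian.supCkENorm (U : Set Literature.Geometry.Lorentzian.E4) 0 (𝒟.toSpacetime.deviationExtend (Literature.Geometry.Lorentzian.Minkowski.backgroundOn U) Ψ) ≤ 1 / 2) → ∃ (O : Set 𝒟.carrier) (d : Literature.Geometry.Lorentzian.FinalStateDecomposition 𝒟.toSpacetime O 2), O = _root_.Summit.FinalStateConjecture.exteriorOf 𝒟.toCauchyDevelopment d.charted ∧ _root_.Summit.FinalStateConjecture.HasExhaustiveCharts d)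

/-- **`K1` is refuted by (F1) + (F2) at a single mass**, the energy input (F3) being the theorem
`rw_channelEnergy_le`.  (F1): near-side velocity data are orthogonal to the kernel; (F2): horizon-side
turning-point beams — both stated inline.  Chain for the beam `φ` of (F2) at `ρ = ρ₀(M)`,
`ε = c(M)/2`: `c·E₀ ≤ c·kernelDeficit ≤ ch⁺ + ch⁻ ≤ E_ext(T) + E_ext(−T) ≤ (c/2)·E₀`, `0 < E₀ < ∞`.
[folklore] -/
theorem not_uniformPhotonSphereChannels_of {M : ℝ} (hM : 0 < M)
    (h1 : ∀ (r : ℝ → ℝ) (xc : ℝ), IsTortoiseRadius M r xc → ∀ ℓ : ℕ, 2 ≤ ℓ → ∀ ρ : ℝ, 0 ≤ ρ →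
      ∀ φ : ℝ → ℝ → ℝ, IsSolution (linePotential M 2 ℓ r) φ → nearVelocityEnergy xc ρ φ < ∞ →
        nearVelocityEnergy xc ρ φ ≤ kernelDeficit (linePotential M 2 ℓ r) xc ρ φ)
    (h2 : ∀ (r : ℝ → ℝ) (xc : ℝ), IsTortoiseRadius M r xc → ∀ ρ : ℝ, 0 ≤ ρ → ∀ ε : ℝ, 0 < ε →
      ∃ ℓ : ℕ, 2 ≤ ℓ ∧ ∃ φ : ℝ → ℝ → ℝ, IsSolution (linePotential M 2 ℓ r) φ ∧ ∃ T : ℝ, 0 ≤ T ∧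
        0 < nearVelocityEnergy xc ρ φ ∧ nearVelocityEnergy xc ρ φ < ∞ ∧
          exteriorEnergy (linePotential M 2 ℓ r) xc ρ φ T +
              exteriorEnergy (linePotential M 2 ℓ r) xc ρ φ (-T) ≤
            ENNReal.ofReal ε * nearVelocityEnergy xc ρ φ) :
    ¬ UniformPhotonSphereChannels := by
  intro hK
  obtain ⟨ρ₀, hρ₀, c, hc, H⟩ := hK M hM
  obtain ⟨r, hr⟩ := exists_isTortoiseRadius hM 0
  obtain ⟨ℓ, hℓ, φ, hφ, T, hT, hE0, hEtop, hbeam⟩ := h2 r 0 hr ρ₀ hρ₀ (c / 2) (by positivity)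
  have hineq : ENNReal.ofReal c * kernelDeficit (linePotential M 2 ℓ r) 0 ρ₀ φ ≤
      channelEnergy (linePotential M 2 ℓ r) 0 ρ₀ φ atTop +
        channelEnergy (linePotential M 2 ℓ r) 0 ρ₀ φ atBot :=
    H r 0 hr.two_mul_lt hr.hasDerivAt hr.center 2 ℓ le_rfl hℓ ρ₀ le_rfl φ hφ.1 hφ.2
  have hF1 := h1 r 0 hr ℓ hℓ ρ₀ hρ₀ φ hφ hEtop
  obtain ⟨htop, hbot⟩ := rw_channelEnergy_le hr hℓ hρ₀ hφ hT
  have key : ENNReal.ofReal c * nearVelocityEnergy 0 ρ₀ φ ≤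
      ENNReal.ofReal (c / 2) * nearVelocityEnergy 0 ρ₀ φ :=
    calc ENNReal.ofReal c * nearVelocityEnergy 0 ρ₀ φ
        ≤ ENNReal.ofReal c * kernelDeficit (linePotential M 2 ℓ r) 0 ρ₀ φ := by gcongr
      _ ≤ channelEnergy (linePotential M 2 ℓ r) 0 ρ₀ φ atTop +
            channelEnergy (linePotential M 2 ℓ r) 0 ρ₀ φ atBot := hineq
      _ ≤ exteriorEnergy (linePotential M 2 ℓ r) 0 ρ₀ φ T +
            exteriorEnergy (linePotential M 2 ℓ r) 0 ρ₀ φ (-T) := add_le_add htop hbot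
      _ ≤ ENNReal.ofReal (c / 2) * nearVelocityEnergy 0 ρ₀ φ := hbeam
  have key' : ENNReal.ofReal c ≤ ENNReal.ofReal (c / 2) :=
    (ENNReal.mul_le_mul_iff_left hE0.ne' hEtop.ne).1 key
  rw [ENNReal.ofReal_le_ofReal_iff (by positivity)] at key'
  linarith

/-- **Hence the crux holds EX FALSO from (F1) + (F2)** at any single mass `M > 0`: the precise
sense in which `ChannelsResolveTameDevelopments` resists disproof as typed (its refutable content is
its consequent alone). [folklore] -/
theorem channelsResolveTameDevelopments_of {M : ℝ} (hM : 0 < M)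
    (h1 : ∀ (r : ℝ → ℝ) (xc : ℝ), IsTortoiseRadius M r xc → ∀ ℓ : ℕ, 2 ≤ ℓ → ∀ ρ : ℝ, 0 ≤ ρ →
      ∀ φ : ℝ → ℝ → ℝ, IsSolution (linePotential M 2 ℓ r) φ → nearVelocityEnergy xc ρ φ < ∞ →
        nearVelocityEnergy xc ρ φ ≤ kernelDeficit (linePotential M 2 ℓ r) xc ρ φ)
    (h2 : ∀ (r : ℝ → ℝ) (xc : ℝ), IsTortoiseRadius M r xc → ∀ ρ : ℝ, 0 ≤ ρ → ∀ ε : ℝ, 0 < ε →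
      ∃ ℓ : ℕ, 2 ≤ ℓ ∧ ∃ φ : ℝ → ℝ → ℝ, IsSolution (linePotential M 2 ℓ r) φ ∧ ∃ T : ℝ, 0 ≤ T ∧
        0 < nearVelocityEnergy xc ρ φ ∧ nearVelocityEnergy xc ρ φ < ∞ ∧
          exteriorEnergy (linePotential M 2 ℓ r) xc ρ φ T +
              exteriorEnergy (linePotential M 2 ℓ r) xc ρ φ (-T) ≤
            ENNReal.ofReal ε * nearVelocityEnergy xc ρ φ) :
    ChannelsResolveTameDevelopments :=
  fun hK ↦ absurd hK (not_uniformPhotonSphereChannels_of hM h1 h2)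

end Reduction


end Summit.FinalStateConjecture.FinalStateConjecture.Theorems.ChannelsResolveTameDevelopments.Negative

end
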